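import Summits.QuantumFields.YangMills.Theorems.BalabanUVNodesN27AtKernelPinnedReading13CoPH
import Summits.QuantumFields.YangMills.Theorems.BalabanUVNodesD4KernelDecayOfWindowed
import Summits.QuantumFields.YangMills.Theorems.BalabanUVNodesN18KernelStepRateBoxes
import Literature.MathematicalPhysics.QuantumFieldTheory.Balaban1983to89.Node00.U3KernelLetters

/-!
# BalabanUVNodes ∕ N27 = binder B5 AT THE RECORD — module (Kᴸ): THE K3⁷ REDUCTION AT A KERNEL-PINNED STAGE-13 RATE READING WITH **EVERY U3-KEYED SLOT READ OFF node00-def-W1's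
# FINITE-VOLUME KERNEL LETTERS OF RECORD** (W1-19b `Node00/U3KernelLetters`, p≈594xxx): per guarded admissible tuple the FOUR letters `PolLimitsExistOfRecord₁₃ F N θ` ((1.21) exists on the
# window), `WindowedNE9OfRecord₁₃ F N θ κ Λ` (windowed joint history-Lipschitz bounds), `WindowedDecayOfRecord₁₃ F N θ 0 1 κ` (windowed (5.10) bounds), `WindowedStepRateOfRecord₁₃ F N θ s κ θ₅
# (C₅·θ₅)` (windowed two-run step rate on the boxes) — and the three letter inequalities `Signs`, `0 < κ`, `betaPrime510 4 1 κ ≤ cr` — give the three U3 rows: **N22** by dag-n22-w3's (1.21)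
# passage `n22At_u3OfRecord₁₃_objectsOfRecord₁₃_of_windowed` (p593053), **(D4)** by dag-n22-w3's windowed ⇒ (5.10) `kernelDecayOfRecord₁₃_of_windowed` (`…D4KernelDecayOfWindowed`) composed
# with this seat's g0 (5.10) ⇒ (D4) (p591653, inside (K)), **N18** by dag-n18-w1's finite-volume reduction `n18At_u3OfRecord₁₃_objects_of_finiteVolume` (`…N18KernelStepRateBoxes` p594018),
# N17 ELIMINATED (inside (K)); N14 ∕ N15 generic, N16 IN THE CURRENCY OF RECORD «R-β»; over module (K) `…N27AtKernelPinnedReading13CoPH` §2 `spine_rec13CCoPHOn_holder_of_kernels_pin` BY NAME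
# (cell `pub-ymgap`, HUMAN RULING D-0062 Track A; director-ym №197 ∕ HUMAN RULING D-0149; width seat `pub-ymgap-dag-n27-w1` gen 2 on NODE n27 (B5 composite); K3⁷
# `SpineGivenEndpointR13SepCoPH` = stmt-QuantumFields-20544, `--kind proof --supports 20544 --as helper`; COUNT-NEUTRAL; THEOREMS ONLY, 0 `def`, 0 `sorry`; `N`-generic,
# regime-generic, NO Theses import — the item-facing face is leaf (Kᴸ′) `…N27SpineGivenEndpointR13SepCoPHKernelLetters`)

WHAT IS KERNEL-CHECKED ([bookkeeping]).
* §1 the three U3 rows in guarded θ-form at the kernel bundle of record FROM THE LETTERS: `n22At_kernels_of_letters_guarded` · `kernelDecayOfRecord₁₃_of_letters_guarded` (the (5.10)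
  clause `KernelDecayOfRecord₁₃ F N θ 0 1 κ` = (K)'s `hdec`) · `n18At_kernels_of_letters_guarded`.
* §2 ★★ `spine_rec13CCoPHOn_holder_of_kernels_pin_of_letters` — N27 = B5 at node00-def-RR-2's regime record class from: the pin `hpin` (K3⁷ v3 `U3PinnedKernels 𝔯 ℓ` verbatim); N14 ∕
  N15 ∕ N16-at-β stubs at the regime home of `𝔯`; per guarded tuple the four letters + three letter inequalities (run offset reading `s F θ`); K5's `h20 h21`, `hx`, the N19′ edge `h19` at
  exponent β — verbatim from (K).

HONEST FRAMING.  COMPOSITE-node bookkeeping BY NAME; a REDUCTION, not a discharge: the four letters are DISPLAYED HYPOTHESES (binders; def-W1's docstrings: NO inhabitant, nothing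
asserted about Bałaban's objects) — the windowed joint history-Lipschitz bounds and the windowed two-run step rate are finite-volume statements of Bałaban-type SHAPE (NOT PRINTED as such for
d = 4), the windowed (5.10) bounds are print's (5.10) p. 293 read before the limit, (1.21)'s existence is [Balaban1987RG1] p. 264 «this limit exists by (1.7)» — none proved here or anywhere
in the tree at these objects; NE1′, NE2, NE3 at exponent β, NE7-cluster, the K5 stubs, the N19′ edge are hypotheses inhabited for no family today (K0⁷ OPEN); β a LETTER; nothing of
Bałaban's asserted or instantiated; no `Provisos₁₃CoPH` inhabitant claimed; N17 ∕ N18 ∕ N22 ∕ N27 NOT discharged; K3⁷ OPEN, NOT claimed; skeleton v3 02f6f498332fdbee and every landed decl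
UNTOUCHED (additive file); counts UNMOVED (typed 28∕28 · discharged 5∕27, A 5∕28); one finite four-torus programme at fixed `ε` — R4 closes the conditional rung `BalabanLadder.UV` only:
NOT ℝ⁴, NOT infinite volume, NOT OS, NOT a mass gap, NOT Clay.  No decl below carries a cite tag.
-/

set_option autoImplicit false

namespace Summit.QuantumFields.YangMills.Theorems.BalabanUVNodesN27SpineRecord

open scoped Matrix.Norms.L2Operator
open Literature.MathematicalPhysics.QuantumFieldTheory.Balaban1983to89
open Literature.MathematicalPhysics.QuantumFieldTheory.Balaban1983to89.T4Continuum
open Literature.MathematicalPhysics.QuantumFieldTheory.Balaban1983to89.B12Sec2to5 (betaPrime510)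
open Literature.MathematicalPhysics.QuantumFieldTheory.Balaban1983to89.Node00.U3OfKernels (objectsOfRecord₁₃ KernelDecayOfRecord₁₃)
open Literature.MathematicalPhysics.QuantumFieldTheory.Balaban1983to89.Node00.U3KernelLetters (PolLimitsExistOfRecord₁₃ WindowedNE9OfRecord₁₃ WindowedDecayOfRecord₁₃
  WindowedStepRateOfRecord₁₃ PolLimitsExistOfRecord₁₃.box)
open T4ContinuumYM4Torus (ForSmallCouplings)
open Summit.QuantumFields.BalabanUV.T4Continuum.Spine
open YMDAG.UVSplit
open Node00 (Stage13HParams datumOfRecord₁₃CoPH U3Letters₁₁)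
open Summit.QuantumFields.YangMills.BalabanUVNodes.N16HolderDefs (S_N16Holder)
open Summit.QuantumFields.YangMills.BalabanUVNodes.SpineRatesHolder (RatesHolderAt)
open YMDAG.N22.AtKernels (n22At_u3OfRecord₁₃_objectsOfRecord₁₃_of_windowed kernelDecayOfRecord₁₃_of_windowed)
open YMDAG.N18.KernelStepRateBoxes (n18At_u3OfRecord₁₃_objects_of_finiteVolume)

variable {N : ℕ} [NeZero N] (cr : SpineReading₁₃CoPH N) (β : ℝ) (𝔯 : RateReading₁₃CoPH N) (Rg : (F : T4Family) → Stage13HParams F N → Prop)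
  (ℓ : (F : T4Family) → Stage13HParams F N → U3Letters₁₁) (s : (F : T4Family) → Stage13HParams F N → ℕ)

/-! ## §1 The three U3 rows at the kernel bundle of record from def-W1's letters of record (guarded θ-form) -/

/-- **N22 FROM THE LETTERS** (dag-n22-w3's (1.21) passage per tuple): `(ℓ F θ).Signs` + `PolLimitsExistOfRecord₁₃` + `WindowedNE9OfRecord₁₃ … (ℓ F θ).κ (ℓ F θ).moduli` (the letters ARE n22-w3's raw
binders, `Iff.rfl`).  LOCATED; N22 NOT discharged. [bookkeeping] -/
theorem n22At_kernels_of_letters_guarded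
    (hs : ∀ (F : T4Family) (θ : Stage13HParams F N), θ.Provisos₁₃CoPH F N → Rg F θ → θ.Admissible F N → (ℓ F θ).Signs)
    (hL : ∀ (F : T4Family) (θ : Stage13HParams F N), θ.Provisos₁₃CoPH F N → Rg F θ → θ.Admissible F N → PolLimitsExistOfRecord₁₃ F N θ.toStage13Params)
    (h9 : ∀ (F : T4Family) (θ : Stage13HParams F N), θ.Provisos₁₃CoPH F N → Rg F θ → θ.Admissible F N → WindowedNE9OfRecord₁₃ F N θ.toStage13Params (ℓ F θ).κ (ℓ F θ).moduli) :
    ∀ (F : T4Family) (θ : Stage13HParams F N), θ.Provisos₁₃CoPH F N → Rg F θ → θ.Admissible F N → ∀ k : ℕ,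
      N22At (u3OfRecord₁₃ θ.toStage13Params (objectsOfRecord₁₃ F N θ.toStage13Params (ℓ F θ)) k) :=
  fun F θ hP hRg hθ k =>
    n22At_u3OfRecord₁₃_objectsOfRecord₁₃_of_windowed F N θ.toStage13Params (ℓ F θ) (hs F θ hP hRg hθ) k (hL F θ hP hRg hθ) (h9 F θ hP hRg hθ)

/-- **THE (5.10) CLAUSE OF RECORD FROM THE LETTERS** (dag-n22-w3's windowed ⇒ (5.10) per tuple): `PolLimitsExistOfRecord₁₃` + `WindowedDecayOfRecord₁₃ … 0 1 (ℓ F θ).κ` ⇒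
`KernelDecayOfRecord₁₃ F N θ 0 1 (ℓ F θ).κ` — (K)'s `hdec`.  LOCATED; (5.10) NOT proved. [bookkeeping] -/
theorem kernelDecayOfRecord₁₃_of_letters_guarded
    (hL : ∀ (F : T4Family) (θ : Stage13HParams F N), θ.Provisos₁₃CoPH F N → Rg F θ → θ.Admissible F N → PolLimitsExistOfRecord₁₃ F N θ.toStage13Params)
    (hW : ∀ (F : T4Family) (θ : Stage13HParams F N), θ.Provisos₁₃CoPH F N → Rg F θ → θ.Admissible F N → WindowedDecayOfRecord₁₃ F N θ.toStage13Params 0 1 (ℓ F θ).κ) :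
    ∀ (F : T4Family) (θ : Stage13HParams F N), θ.Provisos₁₃CoPH F N → Rg F θ → θ.Admissible F N → KernelDecayOfRecord₁₃ F N θ.toStage13Params 0 1 (ℓ F θ).κ :=
  fun F θ hP hRg hθ => kernelDecayOfRecord₁₃_of_windowed F N θ.toStage13Params 0 1 (ℓ F θ).κ (hL F θ hP hRg hθ) (hW F θ hP hRg hθ)

/-- **N18 FROM THE LETTERS** (dag-n18-w1's finite-volume reduction per tuple, at run offset `s F θ`): `PolLimitsExistOfRecord₁₃` (its box form) + `WindowedStepRateOfRecord₁₃ … (s F θ) (ℓ F θ).κ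
(ℓ F θ).θ₅ ((ℓ F θ).C₅ * (ℓ F θ).θ₅)` ⇒ `N18At` at the kernel bundle of record, every run length.  LOCATED; N18 NOT discharged. [bookkeeping] -/
theorem n18At_kernels_of_letters_guarded
    (hL : ∀ (F : T4Family) (θ : Stage13HParams F N), θ.Provisos₁₃CoPH F N → Rg F θ → θ.Admissible F N → PolLimitsExistOfRecord₁₃ F N θ.toStage13Params)
    (hS : ∀ (F : T4Family) (θ : Stage13HParams F N), θ.Provisos₁₃CoPH F N → Rg F θ → θ.Admissible F N →
      WindowedStepRateOfRecord₁₃ F N θ.toStage13Params (s F θ) (ℓ F θ).κ (ℓ F θ).θ₅ ((ℓ F θ).C₅ * (ℓ F θ).θ₅)) :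
    ∀ (F : T4Family) (θ : Stage13HParams F N), θ.Provisos₁₃CoPH F N → Rg F θ → θ.Admissible F N → ∀ k : ℕ,
      N18At (u3OfRecord₁₃ θ.toStage13Params (objectsOfRecord₁₃ F N θ.toStage13Params (ℓ F θ)) k) := by
  intro F θ hP hRg hθ k
  letI := θ.instVβ₁; letI := θ.instVβ₂; letI := θ.instιβ
  exact n18At_u3OfRecord₁₃_objects_of_finiteVolume F _ θ.ρ8 θ.bV θ.toStage13Params (ℓ F θ) k (s F θ) (hL F θ hP hRg hθ).box (hS F θ hP hRg hθ)

/-! ## §2 N27 = B5 at the regime record class from a kernel-pinned reading, every U3 row read off the letters of record -/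

/-- ★★ **N27 = B5 AT node00-def-RR-2's REGIME RECORD CLASS FROM A KERNEL-PINNED STAGE-13 RATE READING, EVERY U3-KEYED SLOT READ OFF def-W1's FINITE-VOLUME KERNEL LETTERS OF
RECORD** ((K) §2 `spine_rec13CCoPHOn_holder_of_kernels_pin` with `h22 ↦` §1's N22 face, `h18 ↦` §1's N18 face, `hdec ↦` §1's (5.10) face): per guarded tuple `PolLimitsExistOfRecord₁₃`,
`WindowedNE9OfRecord₁₃ … κ Λ`, `WindowedDecayOfRecord₁₃ … 0 1 κ`, `WindowedStepRateOfRecord₁₃ … s κ θ₅ (C₅·θ₅)` at the letter block `ℓ F θ` and run offset `s F θ`, plus `Signs`, `0 < κ`,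
`betaPrime510 4 1 κ ≤ cr`; N14 ∕ N15 ∕ N16-at-β stubs at the regime home of `𝔯`; K5's `h20 h21`, `hx`, the N19′ edge `h19` at exponent β.  Every displayed antecedent a HYPOTHESIS (0∕1 at the ₁₃
record today); nothing PROVED of Bałaban's; N27 NOT discharged. [bookkeeping] -/
theorem spine_rec13CCoPHOn_holder_of_kernels_pin_of_letters
    (hpin : ∀ (F : T4Family) (θ : Stage13HParams F N) (hP : θ.Provisos₁₃CoPH F N) (g₀ : ℕ → ℝ) (os : List (ULoop F)),
      (𝔯.lit F θ hP g₀ os).u3 = objectsOfRecord₁₃ F N θ.toStage13Params (ℓ F θ))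
    (h14 : S_N14 (RRec₁₃CoPHOn 𝔯 Rg)) (h15 : S_N15 (RRec₁₃CoPHOn 𝔯 Rg)) (h16 : S_N16Holder β (RRec₁₃CoPHOn 𝔯 Rg))
    (hs : ∀ (F : T4Family) (θ : Stage13HParams F N), θ.Provisos₁₃CoPH F N → Rg F θ → θ.Admissible F N → (ℓ F θ).Signs)
    (hκ : ∀ (F : T4Family) (θ : Stage13HParams F N), θ.Provisos₁₃CoPH F N → Rg F θ → θ.Admissible F N → 0 < (ℓ F θ).κ)
    (hcr : ∀ (F : T4Family) (θ : Stage13HParams F N), θ.Provisos₁₃CoPH F N → Rg F θ → θ.Admissible F N → betaPrime510 4 1 (ℓ F θ).κ ≤ (ℓ F θ).cr)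
    (hL : ∀ (F : T4Family) (θ : Stage13HParams F N), θ.Provisos₁₃CoPH F N → Rg F θ → θ.Admissible F N → PolLimitsExistOfRecord₁₃ F N θ.toStage13Params)
    (h9 : ∀ (F : T4Family) (θ : Stage13HParams F N), θ.Provisos₁₃CoPH F N → Rg F θ → θ.Admissible F N → WindowedNE9OfRecord₁₃ F N θ.toStage13Params (ℓ F θ).κ (ℓ F θ).moduli)
    (hW : ∀ (F : T4Family) (θ : Stage13HParams F N), θ.Provisos₁₃CoPH F N → Rg F θ → θ.Admissible F N → WindowedDecayOfRecord₁₃ F N θ.toStage13Params 0 1 (ℓ F θ).κ)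
    (hS : ∀ (F : T4Family) (θ : Stage13HParams F N), θ.Provisos₁₃CoPH F N → Rg F θ → θ.Admissible F N →
      WindowedStepRateOfRecord₁₃ F N θ.toStage13Params (s F θ) (ℓ F θ).κ (ℓ F θ).θ₅ ((ℓ F θ).C₅ * (ℓ F θ).θ₅))
    (h20 : S_N20 (SRec₁₃CoPHOn cr Rg)) (h21 : S_N21 (SRec₁₃CoPHOn cr Rg))
    (hx : ∀ (F : T4Family) (θ : Stage13HParams F N) (hP : θ.Provisos₁₃CoPH F N), Rg F θ → θ.Admissible F N →
      B16.EndStatementBPrinted (datumOfRecord₁₃CoPH F N θ hP).C → DagBinding.EndpointExistence (datumOfRecord₁₃CoPH F N θ hP).C.toB12 →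
        ForSmallCouplings (datumOfRecord₁₃CoPH F N θ hP) fun g₀ => ∀ os : List (ULoop F),
          0 < (cr F θ hP g₀ os).l₀ ∧ 0 < (cr F θ hP g₀ os).vol ∧
          (∀ (K : ℕ) (t : ℝ), |t| ≤ (cr F θ hP g₀ os).l₀ →
            T4GenFunBounds.schemeZ ((datumOfRecord₁₃CoPH F N θ hP).scheme g₀) os ((cr F θ hP g₀ os).K₀ + K) t =
              ∑ τ ∈ (cr F θ hP g₀ os).T K, (cr F θ hP g₀ os).A K t τ) ∧
          (∀ (K : ℕ) (t : ℝ), |t| ≤ (cr F θ hP g₀ os).l₀ →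
            T4GenFunBounds.schemeZ ((datumOfRecord₁₃CoPH F N θ hP).scheme g₀) os ((cr F θ hP g₀ os).K₀ + K + 1) t =
              ∑ τ ∈ (cr F θ hP g₀ os).T K, (cr F θ hP g₀ os).B K t τ))
    (h19 : ∀ (F : T4Family) (θ : Stage13HParams F N) (hP : θ.Provisos₁₃CoPH F N), Rg F θ → θ.Admissible F N → ∀ (g₀ : ℕ → ℝ) (os : List (ULoop F)),
      (∀ k : ℕ, RatesHolderAt (datumOfRecord₁₃CoPH F N θ hP) (rateCarriersOfRecord₁₃CoPH 𝔯 F θ hP g₀ os k) β) → letI := (cr F θ hP g₀ os).dec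
        ∃ δ : ℕ → ℝ, NE7.Core (cr F θ hP g₀ os).l₀ (cr F θ hP g₀ os).vol (cr F θ hP g₀ os).T (cr F θ hP g₀ os).Bad
          (fun K t τ => (cr F θ hP g₀ os).A K t τ - (cr F θ hP g₀ os).shA K t τ) (fun K t τ => (cr F θ hP g₀ os).B K t τ - (cr F θ hP g₀ os).shB K t τ) δ ∧
          Summable δ) :
    Spine (N := N) fun F D w => Node00.IsRecordOfRecord₁₃CCoPHOn F N Rg D w :=
  spine_rec13CCoPHOn_holder_of_kernels_pin cr β 𝔯 Rg ℓ hpin h14 h15 h16 (n18At_kernels_of_letters_guarded Rg ℓ s hL hS) (n22At_kernels_of_letters_guarded Rg ℓ hs hL h9) hs hκ hcr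
    (kernelDecayOfRecord₁₃_of_letters_guarded Rg ℓ hL hW) h20 h21 hx h19

end Summit.QuantumFields.YangMills.Theorems.BalabanUVNodesN27SpineRecord
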